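import Literature.NumberTheory.LFunctions.TaoLogChowlaProofs
import HarnessLib

/-!
# Hardy–Littlewood–Chowla on average (Lichtman–Teräväinen 2022): the pretentious input (1.12)

Topic `Literature/NumberTheory/Sieve`, companion of `HardyLittlewoodChowla.lean` (the named facts
`lichtmanTeravainen2022_hlc_avg(_liouville)` = J. D. Lichtman, J. Teräväinen, *On the
Hardy–Littlewood–Chowla conjecture on average*, Forum Math. Sigma 10 (2022) e57, arXiv:2111.08912
[LichtmanTeravainen2022], Theorem 1.2 (i)).  Everything in this file is PROVED; it introduces no
definition and no named fact.

The paper's Remark 1.7 / proof of Theorem 1.2 from Theorem 1.6 (held copy `paper:arxiv-2111.08912`,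
p. 4 and §4): "for `f_i = μ` [equally `λ`] the pretentiousness hypothesis (dist) holds by [MRT2015,
(1.12)]: `M(μ; X, Q) ≥ (1/3 − ε) log log X + O(1)` for `Q ≤ (log X)^{1/125}`".  Here from the tree's
proved (1.12) for `λ` (`MatomakiRadziwillTao2015_liouvilleDistLowerBound_holds`), for every `g`
taking the value `-1` at all primes (the pretentious distance only sees prime values):

* `pretentiousDistSq_congr_primes`, `nonpretentiousness_congr_primes` — `𝔻(f, g; x)²` and
  `M(f; x, Q)` depend on `f` only through its values at primes;
* `nonpretentiousness_ge_of_apply_prime` — if `g(p) = -1` for all primes `p` then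
  `M(g; X, Q) ≥ (1/6) log log X − C` for `X ≥ X₀`, `1 ≤ Q ≤ (log X)^{1/125}` (the tree's passage
  from (1.12) to `M`, `MatomakiRadziwillTao2015_theorem13_of_rate`, verbatim).

## References

* J. D. Lichtman, J. Teräväinen, Forum Math. Sigma 10 (2022) e57, arXiv:2111.08912, Remark 1.7
  and §4. [cite: LichtmanTeravainen2022, Remark 1.7]
* K. Matomäki, M. Radziwiłł, T. Tao, Algebra & Number Theory 9 (2015), (1.12).
  [cite: MatomakiRadziwillTao2015, (1.12)]
-/

noncomputable section

open Finset

namespace Literature.NumberTheory.Sieve.LichtmanTeravainen2022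

open Literature.NumberTheory.LFunctions (liouville_complex_apply_prime
  MatomakiRadziwillTao2015_liouvilleDistLowerBound_holds)

/-- `𝔻(f, g; x)²` depends on `f` only through its values at primes. [folklore] -/
theorem pretentiousDistSq_congr_primes {f₁ f₂ : ℕ → ℂ} (h : ∀ p : ℕ, p.Prime → f₁ p = f₂ p)
    (g : ℕ → ℂ) (x : ℝ) : Sieve.pretentiousDistSq f₁ g x = Sieve.pretentiousDistSq f₂ g x := by
  unfold Sieve.pretentiousDistSq
  refine Finset.sum_congr rfl fun p hp => ?_
  rw [h p (Nat.mem_primesLE.1 hp).2]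

/-- `M(f; x, Q)` depends on `f` only through its values at primes. [folklore] -/
theorem nonpretentiousness_congr_primes {f₁ f₂ : ℕ → ℂ} (h : ∀ p : ℕ, p.Prime → f₁ p = f₂ p)
    (x Q : ℝ) : Sieve.nonpretentiousness f₁ x Q = Sieve.nonpretentiousness f₂ x Q := by
  unfold Sieve.nonpretentiousness Sieve.charNonpretentiousness
  simp_rw [pretentiousDistSq_congr_primes h]

/-- **[MRT2015, (1.12)] as a lower bound for `M(g; X, Q)`**, for any `g` with `g(p) = -1` at all
primes (`λ`, `μ`): there are `C, X₀` with `M(g; X, Q) ≥ (1/6) log log X − C` for all `X ≥ X₀` and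
`1 ≤ Q ≤ (log X)^{1/125}`.
[cite: MatomakiRadziwillTao2015, §1 (1.12) (display following Theorem 1.6)] -/
theorem nonpretentiousness_ge_of_apply_prime (g : ℕ → ℂ) (hg : ∀ p : ℕ, p.Prime → g p = -1) :
    ∃ C X₀ : ℝ, ∀ X : ℝ, X₀ ≤ X → ∀ Q : ℝ, 1 ≤ Q → Q ≤ Real.log X ^ (1 / 125 : ℝ) →
      1 / 6 * Real.log (Real.log X) - C ≤ Sieve.nonpretentiousness g X Q := by
  obtain ⟨C₂, X₀, h12⟩ :=
    MatomakiRadziwillTao2015_liouvilleDistLowerBound_holds.pretentiousDistSq_ge (1 / 6) (by norm_num)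
  refine ⟨C₂, max X₀ 0, fun X hX Q hQ1 hQle => ?_⟩
  have hXX₀ : X₀ ≤ X := le_trans (le_max_left _ _) hX
  have hX0 : 0 ≤ X := le_trans (le_max_right _ _) hX
  have hgl : ∀ p : ℕ, p.Prime →
      g p = (ArithmeticFunction.liouville : ArithmeticFunction ℂ) p := fun p hp => by
    rw [hg p hp, liouville_complex_apply_prime hp]
  rw [nonpretentiousness_congr_primes hgl]
  unfold Sieve.nonpretentiousness Sieve.charNonpretentiousness
  haveI : Nonempty (Set.Icc 1 ⌊Q⌋₊) :=
    ⟨⟨1, Set.mem_Icc.2 ⟨le_rfl, Nat.le_floor (by exact_mod_cast hQ1)⟩⟩⟩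
  refine le_ciInf fun q => ?_
  haveI : Nonempty (DirichletCharacter ℂ (q : ℕ)) := ⟨1⟩
  refine le_ciInf fun χ => ?_
  haveI : Nonempty (Set.Icc (-X) X) := ⟨⟨0, Set.mem_Icc.2 ⟨by linarith, hX0⟩⟩⟩
  refine le_ciInf fun t => ?_
  have hq := q.2
  rw [Set.mem_Icc] at hq
  have h := h12 X hXX₀ q χ t hq.1 ?_ (abs_le.2 (Set.mem_Icc.1 t.2))
  · have e : (1 / 3 - 1 / 6 : ℝ) = 1 / 6 := by norm_num
    rw [e] at h
    exact h
  · calc ((q : ℕ) : ℝ) ≤ ⌊Q⌋₊ := by exact_mod_cast hq.2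
      _ ≤ Q := Nat.floor_le (by linarith)
      _ ≤ Real.log X ^ (1 / 125 : ℝ) := hQle

end Literature.NumberTheory.Sieve.LichtmanTeravainen2022
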